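import Summits.ABC.ABC.Theses.CuspFieldPencil
import Summits.ABC.ABC.Theorems.YuMatveevShapeRatCloses
import Summits.ABC.ABC.Theorems.CuspFieldPencilGoldenFromNFPencil
import Summits.ABC.ABC.Theorems.CuspFieldPencilNFPencilOfScoones
import Literature.NumberTheory.DiophantineGeometry.PastenSubexpPlaces
import Literature.Barriers.ABC.BakerMethodBoundsPlaceBoundsProofs
import Literature.NumberTheory.DiophantineGeometry.AbcTwoAdicValuationProofs
import Literature.Barriers.ABC.BakerMethodBounds
import HarnessLib

/-!
# Sketch (stub-ideation k=1, gen 3) for `stub_conjugateCuspTriple` of crux `CuspFieldPencil.GoldenCuspShadow`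

Helper-lemma SIGNATURES only (bodies `sorry`), elaboration-checked; plus the by-name compositions that are
already real proofs.  Namespace is private to this sketch; nothing here is proposed to the tree.
-/

set_option linter.dupNamespace false
set_option linter.unusedVariables false

namespace Summit.ABC.ABC.Cruxes.GoldenCuspShadow.ConjK1G3

open Literature.NumberTheory.DiophantineGeometry
open Literature.NumberTheory.DiophantineGeometry.Dioph (PastenApproximationBound approximationBound_rat)
open Literature.NumberTheory.DiophantineGeometry.Pasten (theta theta_nonneg arch_bound padic_bound_a
  padic_bound_c one_le_log_max_exp)
open Literature.Barriers.ABC (theta_zero_eq theta_zero_pos div_log_mul_add_le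
  log_eq_sum_factorization_mul_log largestPrimeFactor log_lt_route_a_of_placeBounds)
open UniqueFactorizationMonoid

/-! ## 0. The statements -/

/-- The stub, verbatim (`Q := u² − 11uw − w²`, `R := rad(uwQ)`, `H := max(|u|,|w|)`):
`log H ≤ κ · R^ε · rad(Q)^{2/3} · min(rad u, rad w)^{2/3}`. -/
def Sig : Prop := ∀ ε : ℝ, 0 < ε → ∃ κ : ℝ, ∀ u w : ℤ, IsCoprime u w → u * w * (u ^ 2 - 11 * u * w - w ^ 2) ≠ 0 → Real.log (max (|(u : ℝ)|) (|(w : ℝ)|)) ≤ κ * (((UniqueFactorizationMonoid.radical (u * w * (u ^ 2 - 11 * u * w - w ^ 2))).natAbs : ℕ) : ℝ) ^ (ε : ℝ) * ((((UniqueFactorizationMonoid.radical (u ^ 2 - 11 * u * w - w ^ 2)).natAbs : ℕ) : ℝ) ^ (2 / 3 : ℝ) * (min (((UniqueFactorizationMonoid.radical u).natAbs : ℕ) : ℝ) (((UniqueFactorizationMonoid.radical w).natAbs : ℕ) : ℝ)) ^ (2 / 3 : ℝ))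

/-- What the unconditional `ℚ`-line actually proves (`P(n)` = largest prime factor, `P(1)=1`):
`log H ≤ κ_ε · R^ε · min(P(u), P(w))`.  Stronger than the crux; implies the stub whenever
`min(rad u, rad w) ≤ rad(Q)²`. -/
def UWMinP : Prop := ∀ ε : ℝ, 0 < ε → ∃ κ : ℝ, ∀ u w : ℤ, IsCoprime u w →
    u * w * (u ^ 2 - 11 * u * w - w ^ 2) ≠ 0 →
    Real.log (max (|(u : ℝ)|) (|(w : ℝ)|)) ≤
      κ * (((radical (u * w * (u ^ 2 - 11 * u * w - w ^ 2))).natAbs : ℕ) : ℝ) ^ (ε : ℝ) *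
        min ((largestPrimeFactor u.natAbs : ℕ) : ℝ) ((largestPrimeFactor w.natAbs : ℕ) : ℝ)

/-- The rad-form (enough for the crux): `log H ≤ κ_ε · R^ε · min(rad u, rad w)`. -/
def UWMinRad : Prop := ∀ ε : ℝ, 0 < ε → ∃ κ : ℝ, ∀ u w : ℤ, IsCoprime u w →
    u * w * (u ^ 2 - 11 * u * w - w ^ 2) ≠ 0 →
    Real.log (max (|(u : ℝ)|) (|(w : ℝ)|)) ≤
      κ * (((radical (u * w * (u ^ 2 - 11 * u * w - w ^ 2))).natAbs : ℕ) : ℝ) ^ (ε : ℝ) *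
        min (((radical u).natAbs : ℕ) : ℝ) (((radical w).natAbs : ℕ) : ℝ)

/-- Pasten's `Θ` at threshold `0`, closed form on the primes of `n` (`= theta K x y 0` for `n = xy`,
`x ⊥ y`, by `theta_zero_eq`). -/
noncomputable def ThetaZ (K : ℝ) (n : ℕ) : ℝ :=
  K ^ (n.primeFactors.card + 1) * ∏ p ∈ n.primeFactors, Real.log p

/-! ## 1. Helper lemmas of the ℚ-line (TOP plan). H1–H2: member-local place bounds (generic). -/

/-- **H1a (divisor-restricted route through `a`).** For an abc triple and `d ∣ a`:
`log d ≤ Θ_{bc} · Y · 3·∑_{p∣d} p` (`Y = log max(e, 2 log c)`).  Proof = the `hsum` block of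
`log_lt_route_a_of_placeBounds` with `a.primeFactors` replaced by `d.primeFactors`
(`ν_p(d) ≤ ν_p(a)`, `padic_bound_a`, `div_log_mul_add_le`, `log_eq_sum_factorization_mul_log`). ≈40 lines. -/
theorem log_le_of_dvd_a {K : ℝ} (hK : 1 ≤ K) (hP : PastenApproximationBound K) {a b c : ℕ}
    (h : IsABCTriple a b c) {d : ℕ} (hd : d ∣ a) :
    Real.log d ≤ theta K b c 0 * Real.log (max (Real.exp 1) (2 * Real.log c)) *
      (3 * ∑ p ∈ d.primeFactors, (p : ℝ)) := by
  obtain ⟨ha, hb, habc, hcop⟩ := id h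
  set Θ := theta K b c 0 with hΘ
  set Y := Real.log (max (Real.exp 1) (2 * Real.log c)) with hY
  have hY1 : 1 ≤ Y := one_le_log_max_exp _
  have hΘ0 : 0 ≤ Θ := theta_nonneg (zero_le_one.trans hK) b c 0
  have hd0 : d ≠ 0 := (Nat.pos_of_dvd_of_pos hd ha).ne'
  have hlogd : Real.log d = ∑ p ∈ d.primeFactors, (d.factorization p : ℝ) * Real.log p :=
    log_eq_sum_factorization_mul_log hd0
  have hsum : ∑ p ∈ d.primeFactors, (d.factorization p : ℝ) * Real.log p ≤
      ∑ p ∈ d.primeFactors, Θ * (3 * p * Y) := by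
    refine Finset.sum_le_sum fun p hp => ?_
    have hp' := Nat.prime_of_mem_primeFactors hp
    have hpa : p ∣ a := (Nat.dvd_of_mem_primeFactors hp).trans hd
    have h1 := padic_bound_a hK hP h 0 hp' hpa
    have h2 : (p : ℝ) / Real.log p * (Real.log p + Y) ≤ 3 * p * Y :=
      div_log_mul_add_le (by exact_mod_cast hp'.two_le) hY1
    have hfac : (d.factorization p : ℝ) ≤ a.factorization p := by
      exact_mod_cast Finsupp.le_def.mp ((Nat.factorization_le_iff_dvd hd0 ha.ne').mpr hd) p
    have hlogp : 0 ≤ Real.log p := Real.log_nonneg (by exact_mod_cast hp'.one_lt.le)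
    calc (d.factorization p : ℝ) * Real.log p ≤ (a.factorization p : ℝ) * Real.log p :=
          mul_le_mul_of_nonneg_right hfac hlogp
      _ ≤ Θ * ((p : ℝ) / Real.log p * (Real.log p + Y)) := h1.le
      _ ≤ Θ * (3 * p * Y) := mul_le_mul_of_nonneg_left h2 hΘ0
  have hsum' : ∑ p ∈ d.primeFactors, Θ * (3 * p * Y) =
      Θ * Y * (3 * ∑ p ∈ d.primeFactors, (p : ℝ)) := by
    rw [Finset.mul_sum, Finset.mul_sum]
    exact Finset.sum_congr rfl fun p _ => by ring
  rw [hlogd, ← hsum']; exact hsum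

/-- **H1c (divisor-restricted route through `c`).** For an abc triple with `ab > 1` and `d ∣ c`:
`log d ≤ Θ_{ab} · Y · 3·∑_{p∣d} p` (`padic_bound_c`). ≈40 lines. -/
theorem log_le_of_dvd_c {K : ℝ} (hK : 1 ≤ K) (hP : PastenApproximationBound K) {a b c : ℕ}
    (h : IsABCTriple a b c) (h1 : 1 < a * b) {d : ℕ} (hd : d ∣ c) :
    Real.log d ≤ theta K a b 0 * Real.log (max (Real.exp 1) (2 * Real.log c)) *
      (3 * ∑ p ∈ d.primeFactors, (p : ℝ)) := by
  obtain ⟨ha, hb, habc, hcop⟩ := id h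
  set Θ := theta K a b 0 with hΘ
  set Y := Real.log (max (Real.exp 1) (2 * Real.log c)) with hY
  have hc : 0 < c := by omega
  have hY1 : 1 ≤ Y := one_le_log_max_exp _
  have hΘ0 : 0 ≤ Θ := theta_nonneg (zero_le_one.trans hK) a b 0
  have hd0 : d ≠ 0 := (Nat.pos_of_dvd_of_pos hd hc).ne'
  have hlogd : Real.log d = ∑ p ∈ d.primeFactors, (d.factorization p : ℝ) * Real.log p :=
    log_eq_sum_factorization_mul_log hd0
  have hsum : ∑ p ∈ d.primeFactors, (d.factorization p : ℝ) * Real.log p ≤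
      ∑ p ∈ d.primeFactors, Θ * (3 * p * Y) := by
    refine Finset.sum_le_sum fun p hp => ?_
    have hp' := Nat.prime_of_mem_primeFactors hp
    have hpc : p ∣ c := (Nat.dvd_of_mem_primeFactors hp).trans hd
    have h1 := padic_bound_c hK hP h h1 0 hp' hpc
    have h2 : (p : ℝ) / Real.log p * (Real.log p + Y) ≤ 3 * p * Y :=
      div_log_mul_add_le (by exact_mod_cast hp'.two_le) hY1
    have hfac : (d.factorization p : ℝ) ≤ c.factorization p := by
      exact_mod_cast Finsupp.le_def.mp ((Nat.factorization_le_iff_dvd hd0 hc.ne').mpr hd) p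
    have hlogp : 0 ≤ Real.log p := Real.log_nonneg (by exact_mod_cast hp'.one_lt.le)
    calc (d.factorization p : ℝ) * Real.log p ≤ (c.factorization p : ℝ) * Real.log p :=
          mul_le_mul_of_nonneg_right hfac hlogp
      _ ≤ Θ * ((p : ℝ) / Real.log p * (Real.log p + Y)) := h1.le
      _ ≤ Θ * (3 * p * Y) := mul_le_mul_of_nonneg_left h2 hΘ0
  have hsum' : ∑ p ∈ d.primeFactors, Θ * (3 * p * Y) =
      Θ * Y * (3 * ∑ p ∈ d.primeFactors, (p : ℝ)) := by
    rw [Finset.mul_sum, Finset.mul_sum]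
    exact Finset.sum_congr rfl fun p _ => by ring
  rw [hlogd, ← hsum']; exact hsum

/-- **H2 (the hidden `u`-triple, sign-sorted).** `w² + Q = u(u − 11w)`; for coprime `u, w` with
`uwQ ≠ 0` and `u ≠ 11w` exactly one sign pattern holds, and in each the MEMBER `M = |u(u−11w)|` sits in
slot `a` or slot `c`, the other two slots being `w²` and `|Q|` (so `Θ` is generated by the primes of `wQ`
only — the foreign cofactor `u − 11w` never enters `Θ`). `ring`/`omega`/sign cases +
`GoldenFromNFPencil.isCoprime_quadForm_left/right`. ≈60 lines. -/
theorem cuspTriple_u_cases (u w : ℤ) (h : IsCoprime u w)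
    (hne : u * w * (u ^ 2 - 11 * u * w - w ^ 2) ≠ 0) (h11 : u ≠ 11 * w) :
    IsABCTriple (w.natAbs ^ 2) (u ^ 2 - 11 * u * w - w ^ 2).natAbs (u * (u - 11 * w)).natAbs ∨
    IsABCTriple (u * (u - 11 * w)).natAbs (u ^ 2 - 11 * u * w - w ^ 2).natAbs (w.natAbs ^ 2) ∨
    IsABCTriple (u * (u - 11 * w)).natAbs (w.natAbs ^ 2) (u ^ 2 - 11 * u * w - w ^ 2).natAbs := by
  sorry

/-- **H2b (non-degeneracy for `padic_bound_c`).** `w²·|Q| > 1` unless `u ∈ {0, 11w}`. ≈25 lines. -/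
theorem one_lt_wsq_mul_natAbs_Q (u w : ℤ) (hne : u * w * (u ^ 2 - 11 * u * w - w ^ 2) ≠ 0)
    (h11 : u ≠ 11 * w) : 1 < w.natAbs ^ 2 * (u ^ 2 - 11 * u * w - w ^ 2).natAbs := by
  sorry

/-- **H2c (sizes).** The top of the `u`-triple is `≤ 14 H²` and the member dominates `H` up to `12`:
`|u(u−11w)| ≤ 12 H²`, `w² ≤ H²`, `|Q| ≤ 13 H²`; and `H ≤ 12 |u|` whenever `|u(u−11w)|` is the top or
`H = |w|`. (Used to turn `log c`, `log a` into `log H`.) `nlinarith`/`abs` algebra. ≈40 lines. -/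
theorem sizes (u w : ℤ) :
    ((u * (u - 11 * w)).natAbs : ℝ) ≤ 12 * (max (|(u : ℝ)|) (|(w : ℝ)|)) ^ 2 ∧
    ((w.natAbs ^ 2 : ℕ) : ℝ) ≤ (max (|(u : ℝ)|) (|(w : ℝ)|)) ^ 2 ∧
    (((u ^ 2 - 11 * u * w - w ^ 2).natAbs : ℕ) : ℝ) ≤ 13 * (max (|(u : ℝ)|) (|(w : ℝ)|)) ^ 2 := by
  sorry

/-- Sanity instances of H2's three sign patterns and of H2b (`decide`):
`(12,1)`: `1 + 11 = 12` (case 1); `(−1,12)`: `133 + 11 = 144` (case 2); `(2,1)`: `18 + 1 = 19` (case 3). -/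
example : IsABCTriple 1 11 12 ∧ IsABCTriple 133 11 144 ∧ IsABCTriple 18 1 19 := by
  refine ⟨?_, ?_, ?_⟩ <;> exact ⟨by decide, by decide, by decide, by decide⟩
example : ((12 : ℤ) * (12 - 11 * 1)).natAbs = 12 ∧ ((12 : ℤ) ^ 2 - 11 * 12 * 1 - 1 ^ 2).natAbs = 11 ∧
    ((-1 : ℤ) * (-1 - 11 * 12)).natAbs = 133 ∧ ((-1 : ℤ) ^ 2 - 11 * (-1) * 12 - 12 ^ 2).natAbs = 11 ∧
    ((2 : ℤ) * (2 - 11 * 1)).natAbs = 18 ∧ ((2 : ℤ) ^ 2 - 11 * 2 * 1 - 1 ^ 2).natAbs = 19 := by decide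

/-! ### H3: the route through `u` (and, by the symmetry `(u,w) ↦ (w,−u)`, through `w`) -/

/-- **H3 (route through `u`).** `log H ≤ log 12 + Θ(w²|Q|) · Y(14H²) · (1 + 3 ∑_{p∣u} p)`.
From H1a/H1c on the triple of H2 (member `|u(u−11w)|`, divisor `d = |u|`), `arch_bound` when the member
is not the top, H2c for the bookkeeping, `theta_zero_eq` to pass to `ThetaZ`; the degenerate point
`u = 11w` (`H = 11`) is `log 11 ≤ log 12`. ≈90 lines. LOAD-BEARING. -/
theorem route_u {K : ℝ} (hK : 1 ≤ K) (hP : PastenApproximationBound K) (u w : ℤ) (h : IsCoprime u w)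
    (hne : u * w * (u ^ 2 - 11 * u * w - w ^ 2) ≠ 0) :
    Real.log (max (|(u : ℝ)|) (|(w : ℝ)|)) ≤ Real.log 12 +
      ThetaZ K (w.natAbs ^ 2 * (u ^ 2 - 11 * u * w - w ^ 2).natAbs) *
        Real.log (max (Real.exp 1) (2 * Real.log (14 * (max (|(u : ℝ)|) (|(w : ℝ)|)) ^ 2))) *
        (1 + 3 * ∑ p ∈ u.natAbs.primeFactors, (p : ℝ)) := by
  sorry

/-- **H3w (route through `w`)** = H3 at `(w, −u)`: `u² − Q = w(11u + w)`, `uwQ ↦ uwQ`, `Q ↦ −Q`. ≈25 lines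
from H3 (or a verbatim twin). -/
theorem route_w {K : ℝ} (hK : 1 ≤ K) (hP : PastenApproximationBound K) (u w : ℤ) (h : IsCoprime u w)
    (hne : u * w * (u ^ 2 - 11 * u * w - w ^ 2) ≠ 0) :
    Real.log (max (|(u : ℝ)|) (|(w : ℝ)|)) ≤ Real.log 12 +
      ThetaZ K (u.natAbs ^ 2 * (u ^ 2 - 11 * u * w - w ^ 2).natAbs) *
        Real.log (max (Real.exp 1) (2 * Real.log (14 * (max (|(u : ℝ)|) (|(w : ℝ)|)) ^ 2))) *
        (1 + 3 * ∑ p ∈ w.natAbs.primeFactors, (p : ℝ)) := by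
  sorry

/-! ### H4–H6: absorption and self-improvement (generic, small) -/

/-- **H4 (`Θ ≪_δ rad^δ`).** `ThetaZ K n ≤ C · (∏_{p∣n} p)^δ`, from
`exists_pow_card_primeFactors_le_mul_rpow` and `exists_prod_log_primeFactors_le_mul_rpow` at `δ/2`. ≈30 lines. -/
theorem thetaZ_le_mul_rpow {K : ℝ} (hK : 1 ≤ K) {δ : ℝ} (hδ : 0 < δ) :
    ∃ C : ℝ, 1 ≤ C ∧ ∀ n : ℕ, ThetaZ K n ≤ C * (∏ p ∈ n.primeFactors, (p : ℝ)) ^ δ := by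
  sorry

/-- **H5a (sum ≤ product).** `∑_{p∣n} p ≤ ∏_{p∣n} p` (all `p ≥ 2`). ≈15 lines. Enough for the CRUX. -/
theorem sum_primeFactors_le_prod (n : ℕ) :
    ∑ p ∈ n.primeFactors, (p : ℝ) ≤ ∏ p ∈ n.primeFactors, (p : ℝ) := by
  sorry

/-- **H5b (sum ≤ ω·P, ω absorbed).** `∑_{p∣n} p ≤ ω(n) P(n)` and `2^{ω(n)} ≤ C_δ rad(n)^δ`; packaged:
`∑_{p∣n} p ≤ C · (∏_{p∣n} p)^δ · P(n)`. `Finset.sum_le_card_nsmul`, `le_largestPrimeFactor_of_mem_primeFactors`,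
`exists_pow_card_primeFactors_le_mul_rpow (K := 2)`. ≈30 lines. Needed only for the `P`-form `UWMinP`. -/
theorem sum_primeFactors_le_rpow_mul_largestPrimeFactor {δ : ℝ} (hδ : 0 < δ) :
    ∃ C : ℝ, 1 ≤ C ∧ ∀ n : ℕ, ∑ p ∈ n.primeFactors, (p : ℝ) ≤
      C * (∏ p ∈ n.primeFactors, (p : ℝ)) ^ δ * largestPrimeFactor n := by
  sorry

/-- **H6 (self-improvement, public `≤`-twin of the private `StewartYu2001.lt_two_mul_log_of_lt`).**
`X ≤ A · log max(e, 2X)`, `A ≥ 1` ⇒ `X ≤ 2A log(4A)`.  Applied with `X := log 14 + 2 log H` (so that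
`2X = 2 log(14H²)` is the `Y`-argument of H3) and `A := 2·C R^δ(1+3m) + 2 log 12 + log 14`; afterwards
`log(4A) ≤ C_δ' R^δ` by `Real.log_le_rpow_div` since `m ≤ R`. ≈35 lines (copy the private proof). -/
theorem le_two_mul_log_of_le {A X : ℝ} (hA : 1 ≤ A)
    (h : X ≤ A * Real.log (max (Real.exp 1) (2 * X))) : X ≤ 2 * A * Real.log (4 * A) := by
  sorry

/-- **H7 (radical bookkeeping).** `∏_{p ∣ w²|Q|} p ∣ R`-type facts as real inequalities:
`∏_{p∣ (w²·|Q|).primeFactors} p ≤ R`, `∏_{p∣u} p = rad(u).natAbs ≤ R`, with `R = (radical (uwQ)).natAbs`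
(`Int.radical_eq_prod_primeFactors`, `GoldenFromNFPencil.natAbs_radical_prod`, `Nat.primeFactors_mul/pow`). ≈40 lines. -/
theorem rad_bookkeeping (u w : ℤ) (h : IsCoprime u w) (hne : u * w * (u ^ 2 - 11 * u * w - w ^ 2) ≠ 0) :
    ((∏ p ∈ (w.natAbs ^ 2 * (u ^ 2 - 11 * u * w - w ^ 2).natAbs).primeFactors, ((p : ℕ) : ℝ)) *
        (∏ p ∈ u.natAbs.primeFactors, (p : ℝ)) =
      (((radical (u * w * (u ^ 2 - 11 * u * w - w ^ 2))).natAbs : ℕ) : ℝ)) ∧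
    ((∏ p ∈ u.natAbs.primeFactors, (p : ℝ)) = (((radical u).natAbs : ℕ) : ℝ)) ∧
    ((1 : ℝ) ≤ (((radical (u * w * (u ^ 2 - 11 * u * w - w ^ 2))).natAbs : ℕ) : ℝ)) := by
  sorry

/-! ## 2. Assembly targets (to be PROVED by the stub prover from H1–H7; stated here to fix the shapes) -/

/-- **A1.** H3 + H3w + H4 + H5a + H6 + H7 ⇒ the rad-form. ≈80 lines of real-analysis glue. -/
theorem uwMinRad_of (hAB : approximationBound_rat) : UWMinRad := by
  sorry

/-- **A2.** Same with H5b ⇒ the `P`-form. -/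
theorem uwMinP_of (hAB : approximationBound_rat) : UWMinP := by
  sorry

/-- **A3 (crux from the rad-form):** `min(rad u, rad w) ≤ (rad u · rad w)^{1/2} ≤ R^{1/2}`, `ε`-bookkeeping. ≈40 lines. -/
theorem goldenCuspShadow_of_uwMinRad (h : UWMinRad) :
    Summit.ABC.ABC.Theses.CuspFieldPencil.GoldenCuspShadow := by
  sorry

/-- **A4 (stub on its dominant regime from the rad-form):** if `min(rad u, rad w) ≤ rad(Q)²` then
`min ≤ rad(Q)^{2/3} · min^{2/3}`, so the rad-form gives the stub's inequality there (same `κ`). ≈40 lines. -/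
theorem sig_regimeI_of_uwMinRad (h : UWMinRad) : ∀ ε : ℝ, 0 < ε → ∃ κ : ℝ, ∀ u w : ℤ, IsCoprime u w →
    u * w * (u ^ 2 - 11 * u * w - w ^ 2) ≠ 0 →
    min (((radical u).natAbs : ℕ) : ℝ) (((radical w).natAbs : ℕ) : ℝ) ≤
      ((((radical (u ^ 2 - 11 * u * w - w ^ 2)).natAbs : ℕ) : ℝ)) ^ (2 : ℕ) →
    Real.log (max (|(u : ℝ)|) (|(w : ℝ)|)) ≤ κ * (((radical (u * w * (u ^ 2 - 11 * u * w - w ^ 2))).natAbs : ℕ) : ℝ) ^ (ε : ℝ) * ((((radical (u ^ 2 - 11 * u * w - w ^ 2)).natAbs : ℕ) : ℝ) ^ (2 / 3 : ℝ) * (min (((radical u).natAbs : ℕ) : ℝ) (((radical w).natAbs : ℕ) : ℝ)) ^ (2 / 3 : ℝ)) := by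
  sorry

/-! ## 2b. Plan 1 (the stub AS TYPED, modulo the number-field fact): THREE FORMS on the two conjugate sub-pencils -/

section Plan1
open NumberField

/-- THREE FORMS — verbatim the conclusion of `Summit.ABC.ABC.Theorems.NFPencilOfScoones.threeForms_of_scoones2021`
(= registered stub `stub_threeForms` of `NFPencilBound`, stmt-ABC-26250): NF Stewart–Yu exponent `1/3` for three
pairwise non-proportional linear forms over a class-number-one `𝓞_K`. -/
def ThreeForms : Prop := ∀ (K : Type) [Field K] [NumberField K], IsPrincipalIdealRing (𝓞 K) →
      ∀ (α β : Fin 3 → 𝓞 K), (∀ i j, i ≠ j → α i * β j ≠ α j * β i) → ∀ ε : ℝ, 0 < ε →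
        ∃ C : ℝ, ∀ u w : ℤ, IsCoprime u w →
          (∏ i, (α i * (u : 𝓞 K) + β i * (w : 𝓞 K))) ≠ 0 →
            Real.log ((max |u| |w| : ℤ) : ℝ) ≤ C *
              ((∏ i, Ideal.absNorm (Ideal.span {α i * (u : 𝓞 K) + β i * (w : 𝓞 K)}).radical : ℕ) : ℝ) ^
                (1 / (3 : ℝ) + ε)

/-- By name (REAL): THREE FORMS modulo the Scoones fact. -/
theorem threeForms_of_scoones (hS : scoones2021_abcNumberField_classNumberOne) : ThreeForms :=
  Summit.ABC.ABC.Theorems.NFPencilOfScoones.threeForms_of_scoones2021 hS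

/-- **P1 (Plan 1 keystone).** THREE FORMS at `K = ℚ(√5)` (`GoldenFromNFPencil.Golden` set-up: `θ² = θ+1`,
PID instance from `GoldenFieldClassNumberOne`), forms `(u + β₂w, u + β₃w, w)` and `(u + β₂w, u + β₃w, u)`
(`β₂ = −3−5θ`, `β₃ = −8+5θ`, `GoldenFromNFPencil.formTwo_mul_formThree`): product ideal `= (Q·w)` resp. `(Q·u)`,
`N(rad) ≤ rad(Q)²·rad(w)²` (`GoldenFromNFPencil.absNorm_radical_span_intCast_le`, degree 2), exponent
`(1/3+ε')·2 = 2/3 + 2ε'`, surplus `rad^{2ε'} ≤ R^{2ε'}`; `min` of the two bounds. ≈150 lines, 80 % reusable from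
`CuspFieldPencilGoldenFromNFPencil.lean` §4–5 (`goldenFromNFPencil_proof` is the `k = 4` twin). -/
theorem sig_of_threeForms (h3 : ThreeForms) : Sig := by
  sorry

/-- Plan 1 end-to-end (REAL composition once P1 is proved): the stub modulo Scoones, to be landed as
`--supports stmt-ABC-26026 --as helper` (a conditional body under the verbatim `stub_` name bounces `supports.stub-mismatch`). -/
theorem sig_of_scoones (hS : scoones2021_abcNumberField_classNumberOne) : Sig :=
  sig_of_threeForms (threeForms_of_scoones hS)

end Plan1

/-! ## 3. By-name compositions that are already REAL proofs -/

/-- The unconditional input: `∃ K ≥ 1, PastenApproximationBound K` is a tree THEOREM. -/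
example : approximationBound_rat := Summit.ABC.ABC.Theorems.approximationBound_rat_holds

/-- Crux, unconditionally, once A1 and A3 are proved. -/
theorem goldenCuspShadow_unconditional :
    Summit.ABC.ABC.Theses.CuspFieldPencil.GoldenCuspShadow :=
  goldenCuspShadow_of_uwMinRad (uwMinRad_of Summit.ABC.ABC.Theorems.approximationBound_rat_holds)

/-- Plan 1 check: the verbatim stub's `2/3` exponents are the `k = 3` number-field pencil; the tree already
has the `k = 4` instance `GoldenCuspShadow` from Scoones BY NAME (PROVED-MOD-FACT). -/
example (hS : scoones2021_abcNumberField_classNumberOne) :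
    Summit.ABC.ABC.Theses.CuspFieldPencil.GoldenCuspShadow :=
  Summit.ABC.ABC.Theorems.goldenCuspShadow_of_scoones2021 hS

end Summit.ABC.ABC.Cruxes.GoldenCuspShadow.ConjK1G3
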